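import Summits.BirchSwinnertonDyer.BirchSwinnertonDyer.Theses.TameQuarticManinParity
import Summits.BirchSwinnertonDyer.BirchSwinnertonDyer.Theorems.TameQuarticManinParityTwistPairAtThree
import HarnessLib

/-!
# Route `TameQuarticManinParity`, LINE 22 (bsd-idea-3 g8), glue G22 `TprimeIrrManinUnitOfIIIstarHalf`
# (stmt-BirchSwinnertonDyer-28156) — PROVED BY NAME

Cell `pub/bsd-wall`, D-0145 line `route-BirchSwinnertonDyer-TeichmullerTwistDescent`, seat `bsd-line-ttd-p1` g9,
working the planner-of-record's TQMP LINE 22. BSD is NOT proved by this; Manin's conjecture is not proved by this;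
X22 (`TprimeIrrTwistPartnerOptimalDatum`, stmt-28141), O22 (`TprimeIrrTwistLatticeOrientation`), S22
(`TprimeIrrManinLeOfOrientation`, stmt-28140), the ČNS half (24499) and the organ (24498) stay OPEN here. This file
closes ONLY the glue.

## Statement (verbatim the route decl)

`TprimeIrrTwistPartnerOptimalDatum → TprimeIrrTwistLatticeOrientation → TprimeIrrManinLeOfOrientation →
TprimeIrrManinUnitOfDegreePrimeToThree → [organ 24498 on the rows ord₃ Δ_min(W) = 9] →
TprimeIrrManinUnitOfThreeDvdDegree`.

## Proof

Split the (t′) rows by `ord₃ Δ_min ∈ {3, 9}` (`TwistPairAtThree.padicValInt_eq_three_or_nine_of_subTprime`). A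
III* row is the hypothesis. A Kodaira-III row takes its partner `A` from X22 (type III* since the valuations sum to
`12`) with its conductor-level lattice-optimal, degree-minimal datum `D'`; `c(D')` is a `3`-unit by the III*
hypothesis (`3 ∣ deg D'`) or by the ČNS half (`3 ∤ deg D'`); S22, fed the orientation O22 of `W`, transports the
unit to `W` (`N(A) = N(W)`). Pure logic. Design: theorems only; no definition, no named fact, no `sorry`; axioms
`propext`, `Classical.choice`, `Quot.sound`.
-/

set_option autoImplicit false
-- D-0017: single-problem summit, so `Summit.BirchSwinnertonDyer.BirchSwinnertonDyer.…` repeats a namespace BY DESIGN.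
set_option linter.dupNamespace false

namespace Summit.BirchSwinnertonDyer.BirchSwinnertonDyer.Theorems.TameQuarticManinParity

open Summit.BirchSwinnertonDyer.BirchSwinnertonDyer.Theses.TameQuarticManinParity

/-- **Glue G22** (stmt-BirchSwinnertonDyer-28156), by name: X22 ∧ O22 ∧ S22 ∧ ČNS-half ∧ [organ 24498 on the
Kodaira-III* rows] ⟹ organ 24498 on every irreducible (t′) row — the III rows borrow their III* partner's optimal
datum, and S22 transports the unit along the orientation O22. [cite: Stevens1989, Lemmas (5.2), (5.4)] -/
theorem tprimeIrrManinUnitOfIIIstarHalf_proof : TprimeIrrManinUnitOfIIIstarHalf := by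
  unfold TprimeIrrManinUnitOfIIIstarHalf
  intro hX hO hS hCNS hIIIstar W _ _ _ hcm hadd ht hirr D hlat hmin hdeg
  rcases TwistPairAtThree.padicValInt_eq_three_or_nine_of_subTprime W hadd ht with h3 | h9
  · obtain ⟨A, _, _, _, hsum, hAW, hcmA, haddA, htA, hirrA, hNA, D', hlat', hmin'⟩ := hX W hcm hadd ht hirr D
    have h9A : padicValInt 3 A.minimalDiscriminantInt = 9 := by omega
    have hc' : ¬ (3 : ℤ) ∣ D'.maninConstant := by
      by_cases hdeg' : 3 ∣ D'.modularDegree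
      · exact hIIIstar A hcmA haddA htA hirrA h9A D' hlat' hmin' hdeg'
      · exact hCNS A hcmA haddA htA hirrA D' hlat' hmin' hdeg'
    exact hS W hadd ht h3 D hlat (fun h9N χ hχ hprim => hO W hcm hadd ht hirr h3 D h9N χ hχ hprim) A h9A hAW
      (A.conductorNorm ℤ) D' (dvd_of_eq hNA) hc'
  · exact hIIIstar W hcm hadd ht hirr h9 D hlat hmin hdeg

end Summit.BirchSwinnertonDyer.BirchSwinnertonDyer.Theorems.TameQuarticManinParity
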